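import Summits.QuantumFields.YangMills.Theorems.PoincareLipschitzOrbitMinFlatShadow
import Summits.QuantumFields.YangMills.Theorems.PoincareLipschitzOrbitMinBoxEnergy
import Summits.QuantumFields.YangMills.Theorems.PoincareLipschitzOrbitMinBoxWindow
import Summits.QuantumFields.YangMills.Theorems.PoincareLipschitzRegaugeAbsorption
import HarnessLib

/-!
# Crux `HistoryTailL` (stmt-QuantumFields-19936), K2 face v2 `hRegH` (route crux `PoincareLipschitz.BlockLipschitzL`, stmt-QuantumFields-23533) —
# THE FINAL KNIT `hRegH ⟸ hImprove ∧ [C]`, FILE K-1 «FLAT-SHADOW PACKAGE AT A BOND»: at `hRegH`'s prefix, the box-`ℓ²`-orbit minimiser `h` read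
# around a bond `b` with room `R` IS a unit `S³`-valued lattice map on a `ℤ³` box carrying EVERY input row of the organ `hImprove` (v1, LEAD g9
# 899858e5) — twist defect `8(n−1)θ_i`, twisted one-site optimality, local minimality in every sub-box, bounded energy — and the bond itself:
# `‖pertVar (ŪⁱU) ((ŪⁱU′)^h) b‖ = ‖τ_{b.dir} z₀ (u(z₀ + e_{b.dir})) − u z₀‖`

Cell `ym3-torus` (YM ladder rung R3 = continuum SU(2) Yang–Mills on T³ — a RUNG, NOT the Clay problem: not d = 4, not infinite volume, not a mass gap);
LEAD seat `ym-ust-19936-w1` g9 (bus 2026-08-29T06:26:40Z «OWN PEN: THE FINAL KNIT», RULINGS g9-2 «the bond is read at unit radius», g9-5 «hImprove v1»).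
Helper `--supports stmt-QuantumFields-19936`; THEOREMS ONLY (0 `def`, 0 `sorry`, default heartbeats).  A pure COMPOSITION of landed files, following
★w2 g11's `K2-FINAL-KNIT-RECIPE` steps 1–4 + the read-back of step 8: WINDOW ✓`PoincareLipschitzOrbitMinBoxWindow` (plaquette smallness of a K1 box
with room, no wrap-around, the box lies in the reading set), [A] ✓`PoincareLipschitzOrbitMinBoxEnergy` (axial box gauges, regauged minimality, the
plateau energy bound), [T2] ✓`PoincareLipschitzOrbitMinFlatShadow` (`exists_flatShadow`, `localMin_of_dictionary`) over ✓`…FlatShadowLetters` (the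
standard chart), and ✓`PoincareLipschitzRegaugeAbsorption.dist1_mul_inv_eq_norm_pertVar`.  Files K-2 («flat end-game»: hImprove v1 ∧ [C]'s door ⇒ the
bond bound in flat letters) and K-3 (the knit `hRegH_of_hImprove`) consume this file's §3 by name.  Nothing here proves `hImprove`, [C], `hRegH`,
`BlockLipschitzL`, `HistoryTailL` or a summit statement.

WHAT IS PROVED (ns `…Theorems.PoincareLipschitzKnitFlatPackage`).
* §1 letters: `abs_add_le_of_box_subset` (`Q_ρ(z′) ⊆ Q_r(z) ⇒ |z′_k − z_k| + ρ ≤ r`, converse of lit ✓`box_subset_box`), `box_succ_subset_of_box_subset`,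
  `sum_chart_le_sum_of_injOn` (a sum over charted bonds `⟨c y, μ⟩`, `y ∈ Q`, of a nonnegative bond function is at most its sum over any finset
  containing them, the chart injective on `Q`), `val_chart_sub` (K1 offsets of the standard chart `c y = x₀ + y`: `(c y − x₀)_k.val = y_k` for `0 ≤ y_k < N`).
* §2 ★★★ `flatPackage_of_orbitMin` — GENERIC LEVEL: for `V, W` plaquette-`δ`-small on the K1 box of side `n` cornered at `x₀` (`2n ≤ sitesPerDir`), every
  bond based in the box in `S`, and `h` minimising the `S`-orbit energy, the flat shadow `(u, τ)` of the REGAUGED minimiser (axial box gauges) along the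
  chart `c y = x₀ + y`, centred at `z₀ = (n∕2, …, n∕2)` with radius `r` (`1 ≤ r`, `r + 4 ≤ n∕2`), satisfies: `‖u‖ = 1`; twist defect
  `≤ 4(d−1)(n−1)δ·‖w‖` on `Q_{r+1}(z₀)`; twisted one-site optimality on `Q_r(z₀)`; local minimality under unit variations in every sub-box
  `Q_{R′+1}(z′) ⊆ Q_r(z₀)`; `E_τ(u; Q_r(z₀)) ≤ 6(d·n^d)((n∕2−r−3)⁻² + (4(d−1)(n−1)δ)²)`; and the dictionary `‖τ μ y (u(y+e_μ)) − u y‖² = dist1(V_{⟨c y,μ⟩}·((W^h)_{⟨c y,μ⟩})⁻¹)²`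
  at EVERY chart bond (the regauging undone by ✓`dist1_regauge_one`).
* §3 ★★★ `flatPackage_at_prefix` — AT `hRegH`'S PREFIX (T³ letters; the window `winU, winU′`, the orbit-min clause `hmin` on `S_i^M` and the ROOM
  `D_i(b) + R·Lⁱ + 2L^{i+1} + M ≤ 8L^{j+1}` VERBATIM from the frozen face v2 20ad198c), for any K1 side `n` with `3n ≤ R` and radius `r + 4 ≤ n∕2`: the same
  package in `Zd 3` letters with `δ = θ_i := θBal F.L γ b₀ p₀ (K − i)`, `τ₀ = 8(n−1)θ_i`, energy `≤ 18n³((n∕2−r−3)⁻² + (8(n−1)θ_i)²)`, and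
  `‖pertVar (ŪⁱU) ((ŪⁱU′)^h) b‖ = ‖τ b.dir z₀ (u(z₀ + e_{b.dir})) − u z₀‖` (the K1 box is cornered at `x₀ = b₋ − n∕2`, so `c z₀ = b₋`).
HONEST SCOPE.  Bookkeeping over landed letters (SU(2) ≅ S³, axial gauge, Leung–Xin stability bound); the regularity of the minimisers (`hImprove`, [C]) is
NOT here.  YM₃ on T³ is rung R3, not Clay; YM gap NOT proved.

References: T. Bałaban, CMP 98 (1985) 17–51 [Balaban1985Averaging] ((8) p.19, (19)–(20) p.21); CMP 109 (1987) 249–301 [Balaban1987RG1] ((0.1)–(0.4)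
pp.251–253, (0.14) p.254); R. Schoen, K. Uhlenbeck, J. Diff. Geom. 17 (1982) 307–335 [SchoenUhlenbeck1982] (§2); Y. L. Xin, Duke Math. J. 47 (1980) 609–613 [Xin1980].
-/

set_option autoImplicit false

noncomputable section

open scoped BigOperators InnerProductSpace Matrix.Norms.L2Operator
open Matrix WithLp

namespace Summit.QuantumFields.YangMills.Theorems.PoincareLipschitzKnitFlatPackage

open Literature.MathematicalPhysics.QuantumFieldTheory.Balaban1983to89
open B4Eq19LatticeOperators (Zd box unitVec mem_box box_mono box_subset_box self_mem_box add_unitVec_mem_box sub_unitVec_mem_box)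
open Literature.MathematicalPhysics.QuantumFieldTheory.Balaban1983to89.T4AxialGaugeSmallField (axialGauge)
open Summit.QuantumFields.YangMills.Theorems.PoincareLipschitzOrbitMinFlatShadowLetters (chart_add_unitVec injOn_chart_box)
open Summit.QuantumFields.YangMills.Theorems.PoincareLipschitzOrbitMinFlatShadow (exists_flatShadow localMin_of_dictionary)
open Summit.QuantumFields.YangMills.Theorems.PoincareLipschitzOrbitMinBoxEnergy
  (orbitMin_plateau_energy_le orbitMin_regauge dist1_gaugeAct_axialGauge_box_le dist1_regauge_one)

/-! ## §1 Letters: boxes, charts, sums over charted bonds -/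

section Letters
variable {d : ℕ}

/-- If `Q_ρ(z′) ⊆ Q_r(z)` (`ρ ≥ 0`) then `|z′_k − z_k| + ρ ≤ r` for every coordinate (converse of lit ✓`box_subset_box`). [folklore] -/
theorem abs_add_le_of_box_subset {z z' : Zd d} {ρ r : ℤ} (hρ : 0 ≤ ρ) (h : box z' ρ ⊆ box z r) (k : Fin d) :
    |z' k - z k| + ρ ≤ r := by
  have hp : Function.update z' k (z' k + ρ) ∈ box z' ρ := by
    rw [mem_box]; intro j
    by_cases hj : j = k
    · subst hj; simp [abs_of_nonneg hρ]
    · simp [Function.update_of_ne hj, hρ]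
  have hm : Function.update z' k (z' k - ρ) ∈ box z' ρ := by
    rw [mem_box]; intro j
    by_cases hj : j = k
    · subst hj; simp [abs_of_nonneg hρ]
    · simp [Function.update_of_ne hj, hρ]
  have h1 := (mem_box.mp (h hp)) k
  have h2 := (mem_box.mp (h hm)) k
  simp only [Function.update_self] at h1 h2
  rcases abs_le.mp h1 with ⟨_, h1'⟩
  rcases abs_le.mp h2 with ⟨h2', _⟩
  rcases le_or_gt 0 (z' k - z k) with hs | hs
  · rw [abs_of_nonneg hs]; linarith
  · rw [abs_of_neg hs]; linarith

/-- `Q_{ρ+1}(z′) ⊆ Q_r(z)` (`ρ + 1 ≥ 0`) ⟹ `Q_{ρ+2}(z′) ⊆ Q_{r+1}(z)`. [folklore] -/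
theorem box_succ_subset_of_box_subset {z z' : Zd d} {ρ r : ℤ} (hρ : 0 ≤ ρ + 1) (h : box z' (ρ + 1) ⊆ box z r) :
    box z' (ρ + 2) ⊆ box z (r + 1) := by
  refine box_subset_box fun k => ?_
  have := abs_add_le_of_box_subset hρ h k
  linarith
end Letters

section Sums
variable {P : Params} {i : ℕ}

/-- **A SUM OVER CHARTED BONDS IS AT MOST THE SUM OVER ANY SUPERSET OF THEIR IMAGES** (nonnegative summand, chart injective on the box):
`Σ_{y∈Q}Σ_μ f⟨c y, μ⟩ ≤ Σ_{b∈T} f b` when `⟨c y, μ⟩ ∈ T` for `y ∈ Q`. [folklore] -/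
theorem sum_chart_le_sum_of_injOn (f : PBond P i → ℝ) (hf : ∀ b, 0 ≤ f b) (T : Finset (PBond P i)) (Q : Finset (Zd P.d))
    (c : Zd P.d → Site P i) (hinj : Set.InjOn c ↑Q) (hT : ∀ y ∈ Q, ∀ μ, (⟨c y, μ⟩ : PBond P i) ∈ T) :
    ∑ y ∈ Q, ∑ μ, f ⟨c y, μ⟩ ≤ ∑ b ∈ T, f b := by
  classical
  set e : Zd P.d × Fin P.d → PBond P i := fun p => ⟨c p.1, p.2⟩ with he
  have hinj' : Set.InjOn e ↑(Q ×ˢ (Finset.univ : Finset (Fin P.d))) := by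
    intro p hp p' hp' hpp
    have hp1 : p.1 ∈ Q := (Finset.mem_product.mp (Finset.mem_coe.mp hp)).1
    have hp1' : p'.1 ∈ Q := (Finset.mem_product.mp (Finset.mem_coe.mp hp')).1
    have h1 : c p.1 = c p'.1 := congrArg PBond.src hpp
    have h2 : p.2 = p'.2 := congrArg PBond.dir hpp
    exact Prod.ext (hinj hp1 hp1' h1) h2
  have hsub : (Q ×ˢ (Finset.univ : Finset (Fin P.d))).image e ⊆ T := by
    intro b hb
    obtain ⟨p, hp, rfl⟩ := Finset.mem_image.mp hb
    exact hT p.1 (Finset.mem_product.mp hp).1 p.2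
  calc ∑ y ∈ Q, ∑ μ, f ⟨c y, μ⟩ = ∑ p ∈ Q ×ˢ (Finset.univ : Finset (Fin P.d)), f (e p) := by rw [Finset.sum_product]
    _ = ∑ b ∈ (Q ×ˢ (Finset.univ : Finset (Fin P.d))).image e, f b := (Finset.sum_image hinj').symm
    _ ≤ ∑ b ∈ T, f b := Finset.sum_le_sum_of_subset_of_nonneg hsub fun b _ _ => hf b

/-- **CHART OFFSETS**: for the standard chart `c y = x₀ + y`, a point with `0 ≤ y_k < N` has K1 offset `(c y − x₀)_k.val = y_k`. [folklore] -/
theorem val_chart_sub (x₀ : Site P i) (y : Zd P.d) (k : Fin P.d) (h0 : 0 ≤ y k) (hN : y k < (P.sitesPerDir i : ℤ)) :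
    (((fun k => x₀ k + ((y k : ℤ) : ZMod (P.sitesPerDir i)) : Site P i) k - x₀ k).val : ℤ) = y k := by
  have e1 : ((fun k => x₀ k + ((y k : ℤ) : ZMod (P.sitesPerDir i)) : Site P i) k - x₀ k) = ((y k : ℤ) : ZMod (P.sitesPerDir i)) :=
    add_sub_cancel_left _ _
  rw [e1]
  obtain ⟨m, hm⟩ := Int.eq_ofNat_of_zero_le h0
  rw [hm, Int.cast_natCast, ZMod.val_natCast]
  have : m < P.sitesPerDir i := by exact_mod_cast (hm ▸ hN)
  rw [Nat.mod_eq_of_lt this]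
end Sums

/-! ## §2 ★★★ The flat-shadow package at a generic level -/

variable {P : Params} {i : ℕ}

set_option maxHeartbeats 400000 in
/-- ★★★ **THE FLAT-SHADOW PACKAGE OF A BOX-`ℓ²`-ORBIT MINIMISER, GENERIC LEVEL.**  `V, W` level-`i` `SU(2)` fields, plaquette-`δ`-small on the
K1 box `{y : (y_k − x₀_k).val < n}` (`2n ≤ sitesPerDir`); every bond based in the box belongs to `S`; `h` minimises the `S`-orbit energy
`k′ ↦ Σ_{b∈S} dist1(V_b·((W^h)^{k′})_b⁻¹)²`.  Then the flat shadow `(u, τ)` of the regauged minimiser (axial box gauges, ✓`orbitMin_regauge` + ✓`exists_flatShadow`)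
along the standard chart `c y = x₀ + y`, about `z₀ = (n∕2,…,n∕2)` with `1 ≤ r`, `r + 4 ≤ n∕2`, is a unit field with: twist defect `≤ 4(d−1)(n−1)δ` on `Q_{r+1}(z₀)`
(✓`dist1_gaugeAct_axialGauge_box_le`); twisted one-site optimality on `Q_r(z₀)`; local minimality under unit variations supported in any `Q_{R′}(z′)` with
`Q_{R′+1}(z′) ⊆ Q_r(z₀)` (✓`localMin_of_dictionary`, no wrap-around by ✓`injOn_chart_box`); plateau energy `E_τ(u;Q_r(z₀)) ≤ 6(d·n^d)((n∕2−r−3)⁻² + (4(d−1)(n−1)δ)²)`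
(✓`orbitMin_plateau_energy_le` with `a = 1`, `c = n − 2`, `s = n∕2 − r − 3`, read through the dictionary); and the dictionary at every chart bond with the
regauging undone (✓`dist1_regauge_one`). [cite: Balaban1985Averaging, (8) p.19 and (19)-(20) p.21; SchoenUhlenbeck1982, §2; Xin1980, §1] -/
theorem flatPackage_of_orbitMin [DecidableEq (PBond P i)]
    (V W : GaugeField P i (Matrix.specialUnitaryGroup (Fin 2) ℂ)) (S : Finset (PBond P i))
    (h : GaugeTransf P i (Matrix.specialUnitaryGroup (Fin 2) ℂ))
    (hmin : ∀ k' : GaugeTransf P i (Matrix.specialUnitaryGroup (Fin 2) ℂ),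
      (∑ b : PBond P i, if b ∈ S then GaugeGroup.dist1 (V b * (GaugeField.gaugeAct h W b)⁻¹) ^ 2 else 0) ≤
        ∑ b : PBond P i, if b ∈ S then GaugeGroup.dist1 (V b * (GaugeField.gaugeAct k' (GaugeField.gaugeAct h W) b)⁻¹) ^ 2 else 0)
    (x₀ : Site P i) {n : ℕ} (h2n : 2 * n ≤ P.sitesPerDir i) {δ : ℝ} (hδ : 0 ≤ δ)
    (hV : ∀ q : Plaq P i, (∀ k, (q.src k - x₀ k).val < n) → GaugeGroup.dist1 (GaugeField.plaqHol V q) < δ)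
    (hW : ∀ q : Plaq P i, (∀ k, (q.src k - x₀ k).val < n) → GaugeGroup.dist1 (GaugeField.plaqHol W q) < δ)
    (hS : ∀ y : Site P i, (∀ k, (y k - x₀ k).val < n) → ∀ μ, (⟨y, μ⟩ : PBond P i) ∈ S)
    (z₀ : Zd P.d) (hz₀ : ∀ k, z₀ k = ((n / 2 : ℕ) : ℤ)) {r : ℕ} (hr : 1 ≤ r) (hrn : r + 4 ≤ n / 2) :
    ∃ (u : Zd P.d → EuclideanSpace ℝ (Fin 4)) (τ : Fin P.d → Zd P.d → (EuclideanSpace ℝ (Fin 4) ≃ₗᵢ[ℝ] EuclideanSpace ℝ (Fin 4))),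
      (∀ y, ‖u y‖ = 1) ∧
      (∀ y ∈ box z₀ ((r : ℤ) + 1), ∀ (μ : Fin P.d) (w : EuclideanSpace ℝ (Fin 4)),
        ‖τ μ y w - w‖ ≤ (4 * ((((P.d - 1 : ℕ) : ℝ)) * (((n - 1 : ℕ) : ℝ)) * δ)) * ‖w‖) ∧
      (∀ y ∈ box z₀ (r : ℤ),
        ‖∑ μ, (τ μ y (u (y + unitVec μ)) + (τ μ (y - unitVec μ)).symm (u (y - unitVec μ)))‖ • u y =
          ∑ μ, (τ μ y (u (y + unitVec μ)) + (τ μ (y - unitVec μ)).symm (u (y - unitVec μ)))) ∧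
      (∀ (z' : Zd P.d) (R' : ℤ), 0 ≤ R' → box z' (R' + 1) ⊆ box z₀ (r : ℤ) →
        ∀ v : Zd P.d → EuclideanSpace ℝ (Fin 4), (∀ y, y ∉ box z' R' → v y = u y) → (∀ y ∈ box z' R', ‖v y‖ = 1) →
          ∑ y ∈ box z' (R' + 1), ∑ μ, ‖τ μ y (u (y + unitVec μ)) - u y‖ ^ 2 ≤
            ∑ y ∈ box z' (R' + 1), ∑ μ, ‖τ μ y (v (y + unitVec μ)) - v y‖ ^ 2) ∧
      (∑ y ∈ box z₀ (r : ℤ), ∑ μ, ‖τ μ y (u (y + unitVec μ)) - u y‖ ^ 2 ≤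
        6 * ((P.d * n ^ P.d : ℕ) : ℝ) * ((1 / ((n / 2 - r - 3 : ℕ) : ℝ)) ^ 2 + (4 * ((((P.d - 1 : ℕ) : ℝ)) * (((n - 1 : ℕ) : ℝ)) * δ)) ^ 2)) ∧
      (∀ (y : Zd P.d) (μ : Fin P.d), ‖τ μ y (u (y + unitVec μ)) - u y‖ ^ 2 =
        GaugeGroup.dist1 (V ⟨(fun k => x₀ k + ((y k : ℤ) : ZMod (P.sitesPerDir i))), μ⟩ *
          (GaugeField.gaugeAct h W ⟨(fun k => x₀ k + ((y k : ℤ) : ZMod (P.sitesPerDir i))), μ⟩)⁻¹) ^ 2) := by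
  classical
  -- sizes
  have hn8 : 8 ≤ n := by omega
  have hn : 1 ≤ n := by omega
  have hNn : (n : ℤ) < (P.sitesPerDir i : ℤ) := by exact_mod_cast (show n < P.sitesPerDir i by omega)
  -- (1) the axial box gauges and the regauged minimiser
  set g₁ : GaugeTransf P i (Matrix.specialUnitaryGroup (Fin 2) ℂ) :=
    axialGauge V (fun κ => ((x₀ κ).val : ℤ)) (fun κ => ((x₀ κ).val : ℤ) + ((n - 1 : ℕ) : ℤ)) with hg₁
  set g₂ : GaugeTransf P i (Matrix.specialUnitaryGroup (Fin 2) ℂ) :=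
    axialGauge W (fun κ => ((x₀ κ).val : ℤ)) (fun κ => ((x₀ κ).val : ℤ) + ((n - 1 : ℕ) : ℤ)) with hg₂
  set C : ℝ := (((P.d - 1 : ℕ) : ℝ)) * (((n - 1 : ℕ) : ℝ)) * δ with hC
  have hC0 : 0 ≤ C := by positivity
  have hbV : ∀ b : PBond P i, (∀ k, (b.src k - x₀ k).val < n) → (∀ k, (b.tgt k - x₀ k).val < n) →
      GaugeGroup.dist1 (GaugeField.gaugeAct g₁ V b) ≤ C := fun b hs ht => dist1_gaugeAct_axialGauge_box_le V x₀ hn h2n hδ hV b hs ht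
  have hbW : ∀ b : PBond P i, (∀ k, (b.src k - x₀ k).val < n) → (∀ k, (b.tgt k - x₀ k).val < n) →
      GaugeGroup.dist1 (GaugeField.gaugeAct g₂ W b) ≤ C := fun b hs ht => dist1_gaugeAct_axialGauge_box_le W x₀ hn h2n hδ hW b hs ht
  have hmin' := orbitMin_regauge V W S h hmin g₁ g₂
  -- (2) the chart and the flat shadow
  set c : Zd P.d → Site P i := fun y => (fun k => x₀ k + ((y k : ℤ) : ZMod (P.sitesPerDir i))) with hcdef
  have hc : ∀ y μ, c (y + unitVec μ) = Site.shift (c y) μ := fun y μ => chart_add_unitVec x₀ y μ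
  obtain ⟨u, τ, hu0, hu1, hb, hb', hdef, hopt⟩ :=
    exists_flatShadow (GaugeField.gaugeAct g₁ V) (GaugeField.gaugeAct g₂ W) S (fun x => g₁ x * h x * (g₂ x)⁻¹) hmin' c hc
  -- (3) coordinates: ranges of box points and their K1 offsets
  have hrange : ∀ (ρ : ℤ) (y : Zd P.d), y ∈ box z₀ ρ → ∀ k, ((n / 2 : ℕ) : ℤ) - ρ ≤ y k ∧ y k ≤ ((n / 2 : ℕ) : ℤ) + ρ := by
    intro ρ y hy k
    have := (mem_box.mp hy) k
    rw [hz₀ k] at this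
    constructor <;> linarith [(abs_le.mp this).1, (abs_le.mp this).2]
  have hval : ∀ (y : Zd P.d) (k : Fin P.d), 0 ≤ y k → y k < (n : ℤ) → ((c y k - x₀ k).val : ℤ) = y k :=
    fun y k h0 hyn => val_chart_sub x₀ y k h0 (hyn.trans hNn)
  -- every point of `Q_{r+2}(z₀)` charts into the K1 box, with offset `= y_k`
  have hin : ∀ (ρ : ℤ) (y : Zd P.d), ρ ≤ (r : ℤ) + 2 → y ∈ box z₀ ρ → ∀ k, 0 ≤ y k ∧ y k + 2 ≤ (n : ℤ) := by
    intro ρ y hρ hy k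
    have h1 := hrange ρ y hy k
    have h2 : ((n / 2 : ℕ) : ℤ) * 2 ≤ (n : ℤ) := by exact_mod_cast (show n / 2 * 2 ≤ n by omega)
    have h3 : ((r : ℕ) : ℤ) + 4 ≤ ((n / 2 : ℕ) : ℤ) := by exact_mod_cast hrn
    constructor <;> linarith
  have hlt : ∀ (ρ : ℤ) (y : Zd P.d), ρ ≤ (r : ℤ) + 2 → y ∈ box z₀ ρ → ∀ k, (c y k - x₀ k).val < n := by
    intro ρ y hρ hy k
    have h1 := hin ρ y hρ hy k
    have h2 := hval y k h1.1 (by linarith)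
    omega
  -- (4) the package
  refine ⟨u, τ, hu1, ?_, ?_, ?_, ?_, ?_⟩
  · -- twist defect on `Q_{r+1}(z₀)`
    intro y hy μ w
    have hsrc : ∀ k, ((⟨c y, μ⟩ : PBond P i).src k - x₀ k).val < n := hlt _ y (by linarith) hy
    have htgt : ∀ k, ((⟨c y, μ⟩ : PBond P i).tgt k - x₀ k).val < n := by
      have e : (⟨c y, μ⟩ : PBond P i).tgt = c (y + unitVec μ) := (hc y μ).symm
      rw [e]; exact hlt ((r : ℤ) + 1 + 1) _ (by linarith) (add_unitVec_mem_box hy μ)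
    have h1 := hbV ⟨c y, μ⟩ hsrc htgt
    have h2 := hbW ⟨c y, μ⟩ hsrc htgt
    have h3 := hdef y μ w
    have h4 : Real.sqrt (8 * (GaugeGroup.dist1 (GaugeField.gaugeAct g₁ V ⟨c y, μ⟩) ^ 2 +
        GaugeGroup.dist1 (GaugeField.gaugeAct g₂ W ⟨c y, μ⟩) ^ 2)) ≤ 4 * C := by
      have ha := GaugeGroup.dist1_nonneg (GaugeField.gaugeAct g₁ V ⟨c y, μ⟩)
      have hb0 := GaugeGroup.dist1_nonneg (GaugeField.gaugeAct g₂ W ⟨c y, μ⟩)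
      calc Real.sqrt (8 * (GaugeGroup.dist1 (GaugeField.gaugeAct g₁ V ⟨c y, μ⟩) ^ 2 +
            GaugeGroup.dist1 (GaugeField.gaugeAct g₂ W ⟨c y, μ⟩) ^ 2)) ≤ Real.sqrt ((4 * C) ^ 2) := by
            refine Real.sqrt_le_sqrt ?_
            nlinarith [pow_le_pow_left₀ ha h1 2, pow_le_pow_left₀ hb0 h2 2]
        _ = 4 * C := Real.sqrt_sq (by positivity)
    calc ‖τ μ y w - w‖ ≤ Real.sqrt (8 * (GaugeGroup.dist1 (GaugeField.gaugeAct g₁ V ⟨c y, μ⟩) ^ 2 +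
          GaugeGroup.dist1 (GaugeField.gaugeAct g₂ W ⟨c y, μ⟩) ^ 2)) * ‖w‖ := h3
      _ ≤ (4 * C) * ‖w‖ := mul_le_mul_of_nonneg_right h4 (norm_nonneg _)
  · -- twisted one-site optimality on `Q_r(z₀)`
    intro y hy
    refine hopt y (fun μ => hS (c y) (hlt _ y (by linarith) hy) μ) (fun μ => hS (c (y - unitVec μ)) ?_ μ)
    exact hlt ((r : ℤ) + 1) _ (by linarith) (sub_unitVec_mem_box hy μ)
  · -- local minimality in every sub-box
    intro z' R' hR' hsub v hv hv1
    have hsub2 : box z' (R' + 2) ⊆ box z₀ ((r : ℤ) + 1) := box_succ_subset_of_box_subset (by linarith) hsub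
    have hR'r : R' + 1 ≤ (r : ℤ) := by
      have h0 := abs_add_le_of_box_subset (show (0 : ℤ) ≤ R' + 1 by linarith) hsub ⟨0, P.hd⟩
      linarith [abs_nonneg (z' ⟨0, P.hd⟩ - z₀ ⟨0, P.hd⟩)]
    have hinj : Set.InjOn c ↑(box z' (R' + 2)) := by
      refine injOn_chart_box x₀ z' ?_
      have : ((r : ℕ) : ℤ) + 4 ≤ ((n / 2 : ℕ) : ℤ) := by exact_mod_cast hrn
      have : ((n / 2 : ℕ) : ℤ) * 2 ≤ (n : ℤ) := by exact_mod_cast (show n / 2 * 2 ≤ n by omega)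
      linarith
    refine localMin_of_dictionary (GaugeField.gaugeAct g₁ V) (GaugeField.gaugeAct g₂ W) S (fun x => g₁ x * h x * (g₂ x)⁻¹) hmin' c hc
      u τ hu0 hb' z' R' hinj (fun y hy μ => hS (c y) ?_ μ) v hv hv1
    exact hlt (r : ℤ) _ (by linarith) (hsub hy)
  · -- bounded energy on `Q_r(z₀)`: the plateau bound of [A], read through the dictionary
    set s : ℕ := n / 2 - r - 3 with hs
    have hs1 : 1 ≤ s := by omega
    have hA := orbitMin_plateau_energy_le V W S h hmin x₀ (a := 1) (c := n - 2) (s := s) h2n le_rfl (by omega) hs1 hδ hV hW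
    -- the dictionary, with the regauging undone
    have hdict : ∀ y μ, ‖τ μ y (u (y + unitVec μ)) - u y‖ ^ 2 = GaugeGroup.dist1 (V ⟨c y, μ⟩ * (GaugeField.gaugeAct h W ⟨c y, μ⟩)⁻¹) ^ 2 := by
      intro y μ; rw [hb y μ, dist1_regauge_one]
    simp_rw [hdict]
    refine le_trans ?_ hA
    refine sum_chart_le_sum_of_injOn (fun b => GaugeGroup.dist1 (V b * (GaugeField.gaugeAct h W b)⁻¹) ^ 2) (fun b => sq_nonneg _) _ _ c
      (injOn_chart_box x₀ z₀ (by
        have : ((r : ℕ) : ℤ) + 4 ≤ ((n / 2 : ℕ) : ℤ) := by exact_mod_cast hrn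
        have : ((n / 2 : ℕ) : ℤ) * 2 ≤ (n : ℤ) := by exact_mod_cast (show n / 2 * 2 ≤ n by omega)
        linarith)) ?_
    intro y hy μ
    rw [Finset.mem_filter]
    refine ⟨hS (c y) (hlt _ y (by linarith) hy) μ, fun k => ?_⟩
    have e : (⟨c y, μ⟩ : PBond P i).tgt = c (y + unitVec μ) := (hc y μ).symm
    have hy' : y + unitVec μ ∈ box z₀ ((r : ℤ) + 1) := add_unitVec_mem_box hy μ
    have r1 := hrange _ y hy k
    have r2 := hrange _ (y + unitVec μ) hy' k
    have i1 := hin _ y (by linarith) hy k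
    have i2 := hin _ (y + unitVec μ) (by linarith) hy' k
    have v1 := hval y k i1.1 (by linarith)
    have v2 := hval (y + unitVec μ) k i2.1 (by linarith)
    have hsrc_eq : (⟨c y, μ⟩ : PBond P i).src = c y := rfl
    rw [e, hsrc_eq]
    have hn2 : ((n / 2 : ℕ) : ℤ) * 2 ≤ (n : ℤ) ∧ (n : ℤ) ≤ ((n / 2 : ℕ) : ℤ) * 2 + 1 := by constructor <;> push_cast <;> omega
    have hsZ : (s : ℤ) = ((n / 2 : ℕ) : ℤ) - r - 3 := by rw [hs]; push_cast; omega
    have h2n' : 2 ≤ n := by omega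
    refine ⟨?_, ?_, ?_, ?_⟩ <;> zify [h2n'] <;> linarith
  · -- the dictionary at every chart bond
    intro y μ
    rw [hb y μ, dist1_regauge_one]

/-! ## §3 ★★★ The package at `hRegH`'s prefix (T³ letters) -/

section T3
open Literature.MathematicalPhysics.QuantumFieldTheory.Balaban1983to89.T3ContinuumYM3Torus
open Literature.MathematicalPhysics.QuantumFieldTheory.Balaban1983to89.T3UnitScaleTilt (θBal)
open Literature.MathematicalPhysics.QuantumFieldTheory.Balaban1983to89.T3MinimiserStabilityReduction (θBal_pos)
open Summit.QuantumFields.YangMills.Theorems.PoincareLipschitzOrbitMinBoxWindow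
  (plaqSmall_box_of_window two_mul_le_sitesPerDir_of_room mem_readingSet_of_box)
open Summit.QuantumFields.YangMills.Theorems.PoincareLipschitzRegaugeAbsorption (dist1_mul_inv_eq_norm_pertVar)

set_option maxHeartbeats 400000 in
/-- ★★★ **THE FLAT-SHADOW PACKAGE AT `hRegH`'S PREFIX** (K2 face v2, frozen 20ad198c: window `winU winU′`, the orbit-min clause on the reading set
`S_i^M = {b : D_i(b) + 2L^{i+1} + M ≤ 8L^{j+1}}`, the bond `b` with ROOM `D_i(b) + R·Lⁱ + 2L^{i+1} + M ≤ 8L^{j+1}` — all VERBATIM).  For every K1 side `n` with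
`3n ≤ R` and radius `1 ≤ r`, `r + 4 ≤ n∕2`: a unit field `u : ℤ³ → S³ ⊂ ℝ⁴` with bond twists `τ` and a centre `z₀` carrying EVERY input row of the organ
`hImprove` (v1 899858e5) — twist defect `8(n−1)θ_i` on `Q_{r+1}(z₀)` (`θ_i = θBal F.L γ b₀ p₀ (K−i)`), twisted one-site optimality on `Q_r(z₀)`, local minimality
in every sub-box, energy `E_τ(u;Q_r(z₀)) ≤ 18n³((n∕2−r−3)⁻² + (8(n−1)θ_i)²)` — and THE BOND ITSELF: `‖pertVar (ŪⁱU) ((ŪⁱU′)^h) b‖ = ‖τ b.dir z₀ (u(z₀+e_{b.dir})) − u z₀‖`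
(K1 box cornered at `x₀ = b₋ − n∕2`; plaquette smallness and `2n ≤ sitesPerDir` from the window and the room, ✓`plaqSmall_box_of_window` ∕
✓`two_mul_le_sitesPerDir_of_room`; `S`-membership of the box by ✓`mem_readingSet_of_box`; read-back by ✓`dist1_mul_inv_eq_norm_pertVar`; the bond-decidability
is an instance BINDER, so the knit K-3 instantiates it with the instance of its own `hRegH` text).
[cite: Balaban1987RG1, (0.4) p.253 and (0.14) p.254; Balaban1985Averaging, (19)-(20) p.21; SchoenUhlenbeck1982, §2] -/
theorem flatPackage_at_prefix (F : T3Family) {γ b₀ p₀ : ℝ} (hγ : 0 < γ) (hγ1 : γ ≤ 1) (hb₀ : 0 < b₀) {K j i : ℕ} [DecidableEq (PBond (F.P K) i)]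
    (hi : i < j) (hjK : j + 3 ≤ K)
    (a : Plaq (F.P K) (j + 1)) (U U' : GaugeField (F.P K) 0 (Matrix.specialUnitaryGroup (Fin 2) ℂ))
    (hwU : ∀ (i : ℕ) (q : Plaq (F.P K) i), i < j + 1 → Site.tdist (fun k => ((((q.src k).val * F.L ^ i : ℕ)) : ZMod ((F.P K).sitesPerDir 0))) (fun k => ((((a.src k).val * F.L ^ (j + 1) : ℕ)) : ZMod ((F.P K).sitesPerDir 0))) + 64 * F.L ^ i ≤ 64 * F.L ^ (j + 1) → GaugeGroup.dist1 (GaugeField.plaqHol (Averaging.iter (fun i' => BlockAveraging.blockAvg (P := F.P K) (j := i') T3UnitLawDensityEML.ℰp) i U) q) < T3UnitScaleTilt.θBal F.L γ b₀ p₀ (K - i))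
    (hwU' : ∀ (i : ℕ) (q : Plaq (F.P K) i), i < j + 1 → Site.tdist (fun k => ((((q.src k).val * F.L ^ i : ℕ)) : ZMod ((F.P K).sitesPerDir 0))) (fun k => ((((a.src k).val * F.L ^ (j + 1) : ℕ)) : ZMod ((F.P K).sitesPerDir 0))) + 64 * F.L ^ i ≤ 64 * F.L ^ (j + 1) → GaugeGroup.dist1 (GaugeField.plaqHol (Averaging.iter (fun i' => BlockAveraging.blockAvg (P := F.P K) (j := i') T3UnitLawDensityEML.ℰp) i U') q) < T3UnitScaleTilt.θBal F.L γ b₀ p₀ (K - i))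
    (M : ℕ) (h : GaugeTransf (F.P K) i (Matrix.specialUnitaryGroup (Fin 2) ℂ))
    (hmin : ∀ k' : GaugeTransf (F.P K) i (Matrix.specialUnitaryGroup (Fin 2) ℂ), (∑ b : PBond (F.P K) i, if b ∈ Finset.univ.filter (fun b : PBond (F.P K) i => Site.tdist (fun k => ((((b.src k).val * F.L ^ i : ℕ)) : ZMod ((F.P K).sitesPerDir 0))) (fun k => ((((a.src k).val * F.L ^ (j + 1) : ℕ)) : ZMod ((F.P K).sitesPerDir 0))) + 2 * F.L ^ (i + 1) + M ≤ 8 * F.L ^ (j + 1)) then GaugeGroup.dist1 (Averaging.iter (fun i' => BlockAveraging.blockAvg (P := F.P K) (j := i') T3UnitLawDensityEML.ℰp) i U b * (GaugeField.gaugeAct h (Averaging.iter (fun i' => BlockAveraging.blockAvg (P := F.P K) (j := i') T3UnitLawDensityEML.ℰp) i U') b)⁻¹) ^ 2 else 0) ≤ ∑ b : PBond (F.P K) i, if b ∈ Finset.univ.filter (fun b : PBond (F.P K) i => Site.tdist (fun k => ((((b.src k).val * F.L ^ i : ℕ)) : ZMod ((F.P K).sitesPerDir 0))) (fun k => ((((a.src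 k).val * F.L ^ (j + 1) : ℕ)) : ZMod ((F.P K).sitesPerDir 0))) + 2 * F.L ^ (i + 1) + M ≤ 8 * F.L ^ (j + 1)) then GaugeGroup.dist1 (Averaging.iter (fun i' => BlockAveraging.blockAvg (P := F.P K) (j := i') T3UnitLawDensityEML.ℰp) i U b * (GaugeField.gaugeAct k' (GaugeField.gaugeAct h (Averaging.iter (fun i' => BlockAveraging.blockAvg (P := F.P K) (j := i') T3UnitLawDensityEML.ℰp) i U')) b)⁻¹) ^ 2 else 0)
    (b : PBond (F.P K) i) {R : ℝ}
    (hroom : ((Site.tdist (fun k => ((((b.src k).val * F.L ^ i : ℕ)) : ZMod ((F.P K).sitesPerDir 0))) (fun k => ((((a.src k).val * F.L ^ (j + 1) : ℕ)) : ZMod ((F.P K).sitesPerDir 0))) : ℕ) : ℝ) + R * (F.L : ℝ) ^ i + 2 * (F.L : ℝ) ^ (i + 1) + (M : ℝ) ≤ 8 * (F.L : ℝ) ^ (j + 1))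
    {n : ℕ} (hn : 3 * (n : ℝ) ≤ R) {r : ℕ} (hr : 1 ≤ r) (hrn : r + 4 ≤ n / 2) :
    ∃ (u : Zd 3 → EuclideanSpace ℝ (Fin 4)) (τ : Fin 3 → Zd 3 → (EuclideanSpace ℝ (Fin 4) ≃ₗᵢ[ℝ] EuclideanSpace ℝ (Fin 4))) (z₀ : Zd 3),
      (∀ y, ‖u y‖ = 1) ∧
      (∀ y ∈ box z₀ ((r : ℤ) + 1), ∀ (μ : Fin 3) (w : EuclideanSpace ℝ (Fin 4)),
        ‖τ μ y w - w‖ ≤ (8 * (((n - 1 : ℕ) : ℝ)) * T3UnitScaleTilt.θBal F.L γ b₀ p₀ (K - i)) * ‖w‖) ∧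
      (∀ y ∈ box z₀ (r : ℤ),
        ‖∑ μ : Fin 3, (τ μ y (u (y + unitVec μ)) + (τ μ (y - unitVec μ)).symm (u (y - unitVec μ)))‖ • u y =
          ∑ μ : Fin 3, (τ μ y (u (y + unitVec μ)) + (τ μ (y - unitVec μ)).symm (u (y - unitVec μ)))) ∧
      (∀ (z' : Zd 3) (R' : ℤ), 0 ≤ R' → box z' (R' + 1) ⊆ box z₀ (r : ℤ) →
        ∀ v : Zd 3 → EuclideanSpace ℝ (Fin 4), (∀ y, y ∉ box z' R' → v y = u y) → (∀ y ∈ box z' R', ‖v y‖ = 1) →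
          ∑ y ∈ box z' (R' + 1), ∑ μ : Fin 3, ‖τ μ y (u (y + unitVec μ)) - u y‖ ^ 2 ≤
            ∑ y ∈ box z' (R' + 1), ∑ μ : Fin 3, ‖τ μ y (v (y + unitVec μ)) - v y‖ ^ 2) ∧
      (∑ y ∈ box z₀ (r : ℤ), ∑ μ : Fin 3, ‖τ μ y (u (y + unitVec μ)) - u y‖ ^ 2 ≤
        18 * (n : ℝ) ^ 3 * ((1 / ((n / 2 - r - 3 : ℕ) : ℝ)) ^ 2 + (8 * (((n - 1 : ℕ) : ℝ)) * T3UnitScaleTilt.θBal F.L γ b₀ p₀ (K - i)) ^ 2)) ∧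
      ‖BlockAveragingEMLLinearisedBackground.pertVar (Averaging.iter (fun i' => BlockAveraging.blockAvg (P := F.P K) (j := i') T3UnitLawDensityEML.ℰp) i U) (GaugeField.gaugeAct h (Averaging.iter (fun i' => BlockAveraging.blockAvg (P := F.P K) (j := i') T3UnitLawDensityEML.ℰp) i U')) b‖ =
        ‖τ b.dir z₀ (u (z₀ + unitVec (d := 3) b.dir)) - u z₀‖ := by
  classical
  have hd : (F.P K).d = 3 := rfl
  have hL1 : 1 ≤ F.L := by have := F.hL.2; omega
  set θ : ℝ := T3UnitScaleTilt.θBal F.L γ b₀ p₀ (K - i) with hθ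
  have hθ0 : 0 ≤ θ := (θBal_pos hL1 hγ hγ1 hb₀ p₀ (K - i)).le
  set V : GaugeField (F.P K) i (Matrix.specialUnitaryGroup (Fin 2) ℂ) :=
    Averaging.iter (fun i' => BlockAveraging.blockAvg (P := F.P K) (j := i') T3UnitLawDensityEML.ℰp) i U with hV
  set W : GaugeField (F.P K) i (Matrix.specialUnitaryGroup (Fin 2) ℂ) :=
    Averaging.iter (fun i' => BlockAveraging.blockAvg (P := F.P K) (j := i') T3UnitLawDensityEML.ℰp) i U' with hW
  set S : Finset (PBond (F.P K) i) := Finset.univ.filter (fun b : PBond (F.P K) i => Site.tdist (fun k => ((((b.src k).val * F.L ^ i : ℕ)) : ZMod ((F.P K).sitesPerDir 0))) (fun k => ((((a.src k).val * F.L ^ (j + 1) : ℕ)) : ZMod ((F.P K).sitesPerDir 0))) + 2 * F.L ^ (i + 1) + M ≤ 8 * F.L ^ (j + 1)) with hS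
  -- sizes
  have hn8 : 8 ≤ n := by omega
  have h2n : 2 * n ≤ (F.P K).sitesPerDir i := two_mul_le_sitesPerDir_of_room F hi hjK a b M hroom hn
  have hN : n / 2 < (F.P K).sitesPerDir i := by omega
  -- the K1 box corner below the bond
  set x₀ : Site (F.P K) i := fun k => b.src k - ((n / 2 : ℕ) : ZMod ((F.P K).sitesPerDir i)) with hx₀
  have hboff : ∀ k, (b.src k - x₀ k).val < n := by
    intro k
    have e : b.src k - x₀ k = ((n / 2 : ℕ) : ZMod ((F.P K).sitesPerDir i)) := by rw [hx₀]; exact sub_sub_cancel _ _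
    rw [e, ZMod.val_natCast, Nat.mod_eq_of_lt hN]; omega
  have hVs : ∀ q : Plaq (F.P K) i, (∀ k, (q.src k - x₀ k).val < n) → GaugeGroup.dist1 (GaugeField.plaqHol V q) < θ :=
    fun q hq => plaqSmall_box_of_window F hi hjK a U hwU x₀ b hboff M hroom hn q hq
  have hWs : ∀ q : Plaq (F.P K) i, (∀ k, (q.src k - x₀ k).val < n) → GaugeGroup.dist1 (GaugeField.plaqHol W q) < θ :=
    fun q hq => plaqSmall_box_of_window F hi hjK a U' hwU' x₀ b hboff M hroom hn q hq
  have hSs : ∀ y : Site (F.P K) i, (∀ k, (y k - x₀ k).val < n) → ∀ μ, (⟨y, μ⟩ : PBond (F.P K) i) ∈ S := by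
    intro y hy μ
    rw [hS, Finset.mem_filter]
    exact ⟨Finset.mem_univ _, mem_readingSet_of_box F hi hjK a x₀ b hboff M hroom hn y hy⟩
  set z₀ : Zd 3 := fun _ => ((n / 2 : ℕ) : ℤ) with hz₀
  obtain ⟨u, τ, h1, h2, h3, h4, h5, h6⟩ :=
    flatPackage_of_orbitMin V W S h hmin x₀ h2n hθ0 hVs hWs hSs z₀ (fun _ => rfl) hr hrn
  -- constants at `d = 3`
  have e2 : 4 * ((((F.P K).d - 1 : ℕ) : ℝ) * ((n - 1 : ℕ) : ℝ) * θ) = 8 * ((n - 1 : ℕ) : ℝ) * θ := by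
    rw [hd]; push_cast; ring
  have e1 : 6 * (((F.P K).d * n ^ (F.P K).d : ℕ) : ℝ) = 18 * (n : ℝ) ^ 3 := by
    rw [hd]; push_cast; ring
  refine ⟨u, τ, z₀, h1, ?_, h3, h4, ?_, ?_⟩
  · intro y hy μ w
    have := h2 y hy μ w
    rwa [e2] at this
  · have := h5
    rwa [e2, e1] at this
  · -- the bond `b` is the chart bond `⟨c z₀, b.dir⟩`
    have hcz : (fun k => x₀ k + ((z₀ k : ℤ) : ZMod ((F.P K).sitesPerDir i)) : Site (F.P K) i) = b.src := by
      funext k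
      show b.src k - ((n / 2 : ℕ) : ZMod ((F.P K).sitesPerDir i)) + ((((n / 2 : ℕ) : ℤ)) : ZMod ((F.P K).sitesPerDir i)) = b.src k
      rw [Int.cast_natCast, sub_add_cancel]
    have hbb : (⟨(fun k => x₀ k + ((z₀ k : ℤ) : ZMod ((F.P K).sitesPerDir i))), b.dir⟩ : PBond (F.P K) i) = b := by
      rw [hcz]
    have h7 := h6 z₀ b.dir
    rw [hbb] at h7
    have h8 : GaugeGroup.dist1 (V b * (GaugeField.gaugeAct h W b)⁻¹) =
        ‖BlockAveragingEMLLinearisedBackground.pertVar V (GaugeField.gaugeAct h W) b‖ := by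
      rw [← dist1_mul_inv_eq_norm_pertVar, ← GaugeGroup.dist1_inv, _root_.mul_inv_rev, inv_inv]
    rw [h8] at h7
    have ha : 0 ≤ ‖τ b.dir z₀ (u (z₀ + unitVec (d := 3) b.dir)) - u z₀‖ := norm_nonneg _
    have hb' : 0 ≤ ‖BlockAveragingEMLLinearisedBackground.pertVar V (GaugeField.gaugeAct h W) b‖ := norm_nonneg _
    exact ((pow_left_inj₀ ha hb' two_ne_zero).mp h7).symm
end T3

end Summit.QuantumFields.YangMills.Theorems.PoincareLipschitzKnitFlatPackage

end
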